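/-
Copyright (c) 2026 the pub-hodgecm-mathlib formalisation cell (harness21).  Prover seat hodgecm-mathlib-F0P3-p03 (g16): road «S3-ram» (LEAD F0P3a-plan (g13); owner
F0P3a-p06 (g15)); junction J-PACK v2-iso, `row_S45_hyperbolic` HYP-PLAN v1 (F0P3a-p04 (g19)) node (V3)(iv) «REGION LAYERS», lattice half; 2026-09-02.
-/
import Literature.NumberTheory.Automorphic.UnitaryLatticeTreeIsocelesRegionBranchingRamified      -- ★ p848338 (this seat, g15): §11 ∕ §12 branching; brings ★ DIST p847820, ★ S1, ★ LINE TEST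
import Literature.NumberTheory.Rogawski1990.DepthZeroKappaTransferTypeOneRamifiedRootRegionLayers   -- ★ p847622 (F0P3a-p02 (g17)): `ncard_region_eq_of_branching`, `ncard_regionLayer_eq_of_branching`
import Literature.NumberTheory.Automorphic.UnitaryLatticeTreeFixedFiniteModelTransport            -- ★ FIX-FINITE (F0P3a-p05): `finite_setOf_latticeGraphIso_eq_of_eigenframe`
import Literature.NumberTheory.Automorphic.UnitaryLatticeTreeFixedGrandchildFrameRamified          -- ★ FILE L (F0P2-p01): `latticeGraphIso_root_eq_of_mem_unitaryInt`
import Literature.NumberTheory.Automorphic.UnitaryLatticeTreeIsocelesAdaptedRegDirCountRamified       -- ★ (V3′) p848545 ∕ ED. 2 p848562 (F0P3a-p02 (g18)): adapted REGDIR counts, root REGDIR child; brings ★ V0 p848308∕p848356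
import Literature.NumberTheory.Automorphic.UnitaryLatticeTreeIsocelesRegionEndRamified               -- ★ J-END p848515 (A-p16 (g32)): `dist_root_eq_two_mul_iff_not_pow_smul_mem_of_neg`
import HarnessLib

/-!
# The lattice graph of a hermitian space — THE ISOCELES REGION: ITS LAYER SIZES FROM THE PER-VERTEX DIRECTION COUNTS (`#R = 1 + 2q·Σ_{i<s'} qⁱ`, `#END = 2q^{s'}`)
# (Serre, *Trees* I.2.3, II.1.1; Kottwitz 1986 §3; Rogawski 1990 §4.9)

Topic `NumberTheory/Automorphic`; namespace `Literature.NumberTheory.Automorphic.UnitaryLatticeTree`.  THEOREMS ONLY (no definition, no instance, no notation, no named fact,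
no `sorry`); kernel lane `--supports stmt-HodgeConjecture-24833`.  Cell `pub/hodgecm-mathlib` (D-0151), crux H413; road «S3-ram» (Literature seeding, count-neutral); junction
(J★), ISOCELES wave: `row_S45_hyperbolic` (S45 v4 :46, hand F0P3a-p02 (g17∕g18), HYP-PLAN v1 of F0P3a-p04 (g19)), node **(V3)(iv) REGION LAYERS** — the assembly of the two
hypotheses `hcard` ∕ `hend` of ★ `sum_regionTokens_hyperbolic_pool` (p848342) from the PER-VERTEX REGION-DIRECTION COUNT «`= 2` at every region vertex of distance `< 2s'`».

THE MATHEMATICS.  `γ = A·diag(s)·A⁻¹ ∈ K₀` a regular isoceles literal at a tamely ramified place (isolated index `i₀` at depth `d₀ ≥ 3`, close pair `{j, k}` with gap EXACTLY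
`|ϖ|^{d₀+2s'}`, `s' ≥ 1`), root region `R = {γv = v ∧ SD v ∧ LEV[v](ϖ^{d₀})}` (Finset avatar `sR`).  In the rooted tree of fixed vertices (root `r₀ = 𝒪³`, ★ ENGINE ED. 3
bookkeeping: `F = Fix γ` finite (★ FIX-FINITE) and parent-closed, `SD` alternating, grandchildren binder `GC`, `R` closed upwards by ★ S1 `row_regionUpClosed_of_neg`):
* every region vertex lies within `2s'` of the root (★ DIST `dist_root_le_of_lev_of_neg`);
* a region vertex `v = u·r₀` has `q · #{outward region directions}` region grandchildren (★ §11 `ncard_regionGrandchildren_eq_mul_ncard_regDir`), and off the root the inward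
  child is a region direction (★ §12 `ncard_outward_regDir_add_one_eq_ncard_regDir`); so the hypothesis «`#{region directions of v} = 2`» (binder `hdir`, in the κ-keyed
  currency of ★ `lev_iff_v_pairing_lt_one_of_adj_keyed` ∕ ★ (V3)(i) `ncard_adj_regDir_eq_two`, for SOME frame `u` of `v`) gives the branching `2q` at the root and `q` at
  every other region vertex of distance `< 2s'`;
* ★ LAYERS `ncard_region_eq_of_branching` ∕ `ncard_regionLayer_eq_of_branching` then give **`#R = 1 + 2q·Σ_{i<s'} qⁱ`** and **`#{v ∈ R | dist(r₀, v) = 2s'} = 2q^{s'}`**.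

* §13 `ncard_regionGrandchildren_root_eq_of_dirCount` (root: `2q`), `ncard_regionGrandchildren_eq_of_dirCount` (interior: `q`).
* §15 (ED. 2) **`isoceles_regionCard_of_hyperbolic`**: the same conclusion from the S45 v4 binders + `hhyp` ALONE — `hdir` discharged per vertex: interior `dist < 2s'` ⟹ ★ J-END
  `hne` ∘ ★ V0 adapted frame `(u, hvu, hlam)` ∘ ★ (V3′) `ncard_regDir_eq_two_of_adapted`; root ★ (V3′) ED. 2 `exists_regDir_root_child_of_hyperbolic` ∘ ★ `exists_adaptedFrame_root_of_regDir`.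
* §14 **`isoceles_regionCard_of_dirCounts`**: `sR.card = 1 + 2 * q * ∑ i ∈ Finset.range s', q ^ i ∧ (sR.filter (dist r₀ · = 2 * s')).card = 2 * q ^ s'` — the texts of the
  `hcard` ∕ `hend` hypotheses of ★ `sum_regionTokens_hyperbolic_pool` (`PEND v := dist r₀ v = 2 * s'`).

HONEST LABEL: HC_CM is proved only modulo the 2 remaining named inputs (hLiu418 24832, h413 24833) until rung 0 closes; nothing printed is asserted here (rooted-tree bookkeeping
over ★ heads); «S3-ram» has no books consequence.

## References
* [Serre1980Trees] J.-P. Serre, *Trees* (1980), I.2.3 (rooted trees, layers), II.1.1 (lattices, neighbours).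
* [Kottwitz1986] R. E. Kottwitz, *Base change for unit elements of Hecke algebras*, Compositio Math. 60 (1986), §3 (counting fixed lattices shell by shell).
* [Rogawski1990] J. D. Rogawski, *Automorphic Representations of Unitary Groups in Three Variables*, Ann. of Math. Stud. 123 (1990), §4.9 pp. 54–56.
-/

set_option autoImplicit false

noncomputable section

open scoped Valued WithZero Matrix MatrixGroups

namespace Literature.NumberTheory.Automorphic.UnitaryLatticeTree

open Literature.NumberTheory.Automorphic Literature.NumberTheory.Automorphic.HermitianLattice
open Literature.Combinatorics.SimpleGraph.TreeLayers Literature.NumberTheory.Rogawski1990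

variable {K : Type*} [Field K] [Valued K ℤᵐ⁰] {σ : K →+* K} {ϖ : K}

/-! ## §13 The branching numbers from the direction counts -/

/-- **ROOT BRANCHING `2q`**: if `r₀ = u₀·r₀` has exactly two region directions in the frame `u₀`, the root has `2q` region grandchildren (★ §11 at the root; a neighbour of
the root has distance `1`, so every root direction is outward). [cite: Serre1980Trees, I.2.3] [cite: Kottwitz1986, §3] -/
theorem ncard_regionGrandchildren_root_eq_of_dirCount (hσ : ∀ x, σ (σ x) = x) (hvσ : ∀ a, Valued.v (σ a) = Valued.v a) (hσϖ : σ ϖ = -ϖ)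
    (hϖ : Valued.v ϖ = WithZero.exp (-1 : ℤ)) (hres : ∀ x : K, Valued.v x ≤ 1 → Valued.v (σ x - x) < 1) (h2 : Valued.v (2 : K) = 1) [Finite 𝓀[K]]
    (hT : (latticeGraph σ ϖ ((StdForm.antidiagonal 3).over K)).IsTree)
    {γ : unitaryGroupOfForm σ ((StdForm.antidiagonal 3).over K)} (hγ0 : γ ∈ unitaryInt σ ((StdForm.antidiagonal 3).over K))
    (A : GL (Fin 3) K) (hA : IsIntMatrix (A : Matrix (Fin 3) (Fin 3) K)) (hA' : IsIntMatrix ((A⁻¹ : GL (Fin 3) K) : Matrix (Fin 3) (Fin 3) K))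
    {d : Fin 3 → K} (hd : ∀ i, Valued.v (d i) = 1) (hdA : Matrix.diagonal d = (-(Matrix.diagonal d).det) • formCongr σ A ((StdForm.antidiagonal 3).over K))
    (s : Fin 3 → K) (hγA : ((γ : GL (Fin 3) K) : Matrix (Fin 3) (Fin 3) K) = (A : Matrix (Fin 3) (Fin 3) K) * Matrix.diagonal s * ((A⁻¹ : GL (Fin 3) K) : Matrix (Fin 3) (Fin 3) K))
    (i₀ : Fin 3) {d₀ : ℕ} (hd2 : 2 ≤ d₀) (he : ∀ i, Valued.v (s i - 1) ≤ Valued.v ϖ ^ d₀) (hiso : ∀ m, m ≠ i₀ → Valued.v (s i₀ - s m) = Valued.v ϖ ^ d₀) {s' : ℕ}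
    (hgap : ∀ j k, j ≠ i₀ → k ≠ i₀ → j ≠ k → Valued.v (s j - s k) = Valued.v ϖ ^ (d₀ + 2 * s')) {k : Fin 3} (hk : k ≠ i₀)
    (u₀ : unitaryGroupOfForm σ ((StdForm.antidiagonal 3).over K))
    (hru : (⟨stdLattice K 3, 0, isSelfDualLattice_stdLattice_three_of_v hϖ⟩ : {M : Submodule 𝒪[K] (Fin 3 → K) // IsVertex σ ϖ ((StdForm.antidiagonal 3).over K) M}) =
      latticeGraphIso σ ϖ ((StdForm.antidiagonal 3).over K) u₀ ⟨stdLattice K 3, 0, isSelfDualLattice_stdLattice_three_of_v hϖ⟩) {b : ℕ}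
    (hcnt : {c : {M : Submodule 𝒪[K] (Fin 3 → K) // IsVertex σ ϖ ((StdForm.antidiagonal 3).over K) M} | (latticeGraph σ ϖ ((StdForm.antidiagonal 3).over K)).Adj ⟨stdLattice K 3, 0, isSelfDualLattice_stdLattice_three_of_v hϖ⟩ c ∧ ∃ κ : unitaryGroupOfForm σ ((StdForm.antidiagonal 3).over K), κ ∈ unitaryInt σ ((StdForm.antidiagonal 3).over K) ∧
        c = latticeGraphIso σ ϖ ((StdForm.antidiagonal 3).over K) (u₀ * κ) ⟨latt (Matrix.diagonal ![(1 : K), 1, ϖ]), 2, isVertexLattice_two_N₁_of_neg hσϖ hϖ⟩ ∧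
        (Valued.v (pairing σ ((StdForm.antidiagonal 3).over K) ((((u₀ * κ : unitaryGroupOfForm σ ((StdForm.antidiagonal 3).over K)) : GL (Fin 3) K) : Matrix (Fin 3) (Fin 3) K) *ᵥ Pi.single 0 1)
            ((A : Matrix (Fin 3) (Fin 3) K) *ᵥ Pi.single i₀ 1)) < 1 ∧
          Valued.v (pairing σ ((StdForm.antidiagonal 3).over K) ((((u₀ * κ : unitaryGroupOfForm σ ((StdForm.antidiagonal 3).over K)) : GL (Fin 3) K) : Matrix (Fin 3) (Fin 3) K) *ᵥ Pi.single 0 1)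
            (ϖ ^ s' • ((A : Matrix (Fin 3) (Fin 3) K) *ᵥ Pi.single k 1))) < 1)}.ncard = b) :
    {w | w ∈ {w | ∃ c, ((latticeGraph σ ϖ ((StdForm.antidiagonal 3).over K)).Adj ⟨stdLattice K 3, 0, isSelfDualLattice_stdLattice_three_of_v hϖ⟩ c ∧ (latticeGraph σ ϖ ((StdForm.antidiagonal 3).over K)).dist ⟨stdLattice K 3, 0, isSelfDualLattice_stdLattice_three_of_v hϖ⟩ c = (latticeGraph σ ϖ ((StdForm.antidiagonal 3).over K)).dist ⟨stdLattice K 3, 0, isSelfDualLattice_stdLattice_three_of_v hϖ⟩ (⟨stdLattice K 3, 0, isSelfDualLattice_stdLattice_three_of_v hϖ⟩ : {M : Submodule 𝒪[K] (Fin 3 → K) // IsVertex σ ϖ ((StdForm.antidiagonal 3).over K) M}) + 1 ∧ latticeGraphIso σ ϖ ((StdForm.antidiagonal 3).over K) γ c = c) ∧ ((latticeGraph σ ϖ ((StdForm.antidiagonal 3).over K)).Adj c w ∧ (latticeGraph σ ϖ ((StdForm.antidiagonal 3).over K)).dist ⟨stdLattice K 3, 0, isSelfDualLattice_stdLattice_three_of_v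 hϖ⟩ w = (latticeGraph σ ϖ ((StdForm.antidiagonal 3).over K)).dist ⟨stdLattice K 3, 0, isSelfDualLattice_stdLattice_three_of_v hϖ⟩ c + 1 ∧ latticeGraphIso σ ϖ ((StdForm.antidiagonal 3).over K) γ w = w)} ∧
        (latticeGraphIso σ ϖ ((StdForm.antidiagonal 3).over K) γ w = w ∧ IsSelfDualLattice σ ϖ ((StdForm.antidiagonal 3).over K) w.1 ∧
          w.1.map ((Matrix.toLin' (((γ : GL (Fin 3) K) : Matrix (Fin 3) (Fin 3) K) - 1)).restrictScalars 𝒪[K]) ≤ scaleLattice (ϖ ^ d₀) w.1)}.ncard = Nat.card 𝓀[K] * b := by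
  set r : {M : Submodule 𝒪[K] (Fin 3 → K) // IsVertex σ ϖ ((StdForm.antidiagonal 3).over K) M} :=
    ⟨stdLattice K 3, 0, isSelfDualLattice_stdLattice_three_of_v hϖ⟩ with hr
  have hϖ0 : ϖ ≠ 0 := fun h0 => by rw [h0, map_zero] at hϖ; exact WithZero.coe_ne_zero hϖ.symm
  have hfix : latticeGraphIso σ ϖ ((StdForm.antidiagonal 3).over K) γ r = r :=
    Subtype.ext (by rw [latticeGraphIso_apply_coe]; exact mapGL_stdLattice_of_mem_unitaryInt hγ0)
  have hvR : r.1.map ((Matrix.toLin' (((γ : GL (Fin 3) K) : Matrix (Fin 3) (Fin 3) K) - 1)).restrictScalars 𝒪[K]) ≤ scaleLattice (ϖ ^ d₀) r.1 :=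
    map_sub_one_stdLattice_le_scaleLattice_of_eigenframe A hA hA' s hγA (pow_ne_zero _ hϖ0) (fun i => by rw [map_pow]; exact he i)
  rw [ncard_regionGrandchildren_eq_mul_ncard_regDir hσ hvσ hσϖ hϖ hres h2 hT A hd hdA s hγA i₀ hd2 he hiso hgap hk u₀ hru hfix hvR, ← hcnt]
  congr 2
  ext c
  simp only [Set.mem_setOf_eq, and_congr_right_iff]
  intro hadj
  have hd1 : (latticeGraph σ ϖ ((StdForm.antidiagonal 3).over K)).dist r c = (latticeGraph σ ϖ ((StdForm.antidiagonal 3).over K)).dist r r + 1 := by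
    rw [SimpleGraph.dist_self, zero_add]; exact SimpleGraph.dist_eq_one_iff_adj.2 hadj
  exact ⟨fun h => h.2, fun h => ⟨hd1, h⟩⟩

/-- **INTERIOR BRANCHING `q`**: a region vertex `v = u·r₀ ≠ r₀` with exactly two region directions in the frame `u` has `q` region grandchildren — one of the two directions
is the inward child (★ §12), the other carries `q` region far vertices (★ §11). [cite: Serre1980Trees, I.2.3] [cite: Kottwitz1986, §3] -/
theorem ncard_regionGrandchildren_eq_of_dirCount (hσ : ∀ x, σ (σ x) = x) (hvσ : ∀ a, Valued.v (σ a) = Valued.v a) (hσϖ : σ ϖ = -ϖ)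
    (hϖ : Valued.v ϖ = WithZero.exp (-1 : ℤ)) (hres : ∀ x : K, Valued.v x ≤ 1 → Valued.v (σ x - x) < 1) (h2 : Valued.v (2 : K) = 1)
    (hnorm : ∀ u : K, σ u = u → Valued.v (u - 1) < 1 → ∃ z : K, z * σ z = u ∧ Valued.v (z - 1) ≤ Valued.v (u - 1)) [Finite 𝓀[K]]
    [ValuativeRel K] [(Valued.v : Valuation K ℤᵐ⁰).Compatible]
    (hT : (latticeGraph σ ϖ ((StdForm.antidiagonal 3).over K)).IsTree)
    {γ : unitaryGroupOfForm σ ((StdForm.antidiagonal 3).over K)} (hγ0 : γ ∈ unitaryInt σ ((StdForm.antidiagonal 3).over K))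
    (A : GL (Fin 3) K) (hA : IsIntMatrix (A : Matrix (Fin 3) (Fin 3) K)) (hA' : IsIntMatrix ((A⁻¹ : GL (Fin 3) K) : Matrix (Fin 3) (Fin 3) K))
    {d : Fin 3 → K} (hd : ∀ i, Valued.v (d i) = 1) (hdA : Matrix.diagonal d = (-(Matrix.diagonal d).det) • formCongr σ A ((StdForm.antidiagonal 3).over K))
    (s : Fin 3 → K) (hγA : ((γ : GL (Fin 3) K) : Matrix (Fin 3) (Fin 3) K) = (A : Matrix (Fin 3) (Fin 3) K) * Matrix.diagonal s * ((A⁻¹ : GL (Fin 3) K) : Matrix (Fin 3) (Fin 3) K))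
    (i₀ : Fin 3) {d₀ : ℕ} (hd2 : 2 ≤ d₀) (he : ∀ i, Valued.v (s i - 1) ≤ Valued.v ϖ ^ d₀) (hiso : ∀ m, m ≠ i₀ → Valued.v (s i₀ - s m) = Valued.v ϖ ^ d₀) {s' : ℕ}
    (hgap : ∀ j k, j ≠ i₀ → k ≠ i₀ → j ≠ k → Valued.v (s j - s k) = Valued.v ϖ ^ (d₀ + 2 * s')) {k : Fin 3} (hk : k ≠ i₀)
    (u : unitaryGroupOfForm σ ((StdForm.antidiagonal 3).over K)) {v : {M : Submodule 𝒪[K] (Fin 3 → K) // IsVertex σ ϖ ((StdForm.antidiagonal 3).over K) M}}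
    (hvu : v = latticeGraphIso σ ϖ ((StdForm.antidiagonal 3).over K) u ⟨stdLattice K 3, 0, isSelfDualLattice_stdLattice_three_of_v hϖ⟩)
    (hvr : v ≠ ⟨stdLattice K 3, 0, isSelfDualLattice_stdLattice_three_of_v hϖ⟩)
    (hfix : latticeGraphIso σ ϖ ((StdForm.antidiagonal 3).over K) γ v = v)
    (hvR : v.1.map ((Matrix.toLin' (((γ : GL (Fin 3) K) : Matrix (Fin 3) (Fin 3) K) - 1)).restrictScalars 𝒪[K]) ≤ scaleLattice (ϖ ^ d₀) v.1) {b : ℕ}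
    (hcnt : {c : {M : Submodule 𝒪[K] (Fin 3 → K) // IsVertex σ ϖ ((StdForm.antidiagonal 3).over K) M} | (latticeGraph σ ϖ ((StdForm.antidiagonal 3).over K)).Adj v c ∧ ∃ κ : unitaryGroupOfForm σ ((StdForm.antidiagonal 3).over K), κ ∈ unitaryInt σ ((StdForm.antidiagonal 3).over K) ∧
        c = latticeGraphIso σ ϖ ((StdForm.antidiagonal 3).over K) (u * κ) ⟨latt (Matrix.diagonal ![(1 : K), 1, ϖ]), 2, isVertexLattice_two_N₁_of_neg hσϖ hϖ⟩ ∧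
        (Valued.v (pairing σ ((StdForm.antidiagonal 3).over K) ((((u * κ : unitaryGroupOfForm σ ((StdForm.antidiagonal 3).over K)) : GL (Fin 3) K) : Matrix (Fin 3) (Fin 3) K) *ᵥ Pi.single 0 1)
            ((A : Matrix (Fin 3) (Fin 3) K) *ᵥ Pi.single i₀ 1)) < 1 ∧
          Valued.v (pairing σ ((StdForm.antidiagonal 3).over K) ((((u * κ : unitaryGroupOfForm σ ((StdForm.antidiagonal 3).over K)) : GL (Fin 3) K) : Matrix (Fin 3) (Fin 3) K) *ᵥ Pi.single 0 1)
            (ϖ ^ s' • ((A : Matrix (Fin 3) (Fin 3) K) *ᵥ Pi.single k 1))) < 1)}.ncard = b + 1) :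
    {w | w ∈ {w | ∃ c, ((latticeGraph σ ϖ ((StdForm.antidiagonal 3).over K)).Adj v c ∧ (latticeGraph σ ϖ ((StdForm.antidiagonal 3).over K)).dist ⟨stdLattice K 3, 0, isSelfDualLattice_stdLattice_three_of_v hϖ⟩ c = (latticeGraph σ ϖ ((StdForm.antidiagonal 3).over K)).dist ⟨stdLattice K 3, 0, isSelfDualLattice_stdLattice_three_of_v hϖ⟩ v + 1 ∧ latticeGraphIso σ ϖ ((StdForm.antidiagonal 3).over K) γ c = c) ∧ ((latticeGraph σ ϖ ((StdForm.antidiagonal 3).over K)).Adj c w ∧ (latticeGraph σ ϖ ((StdForm.antidiagonal 3).over K)).dist ⟨stdLattice K 3, 0, isSelfDualLattice_stdLattice_three_of_v hϖ⟩ w = (latticeGraph σ ϖ ((StdForm.antidiagonal 3).over K)).dist ⟨stdLattice K 3, 0, isSelfDualLattice_stdLattice_three_of_v hϖ⟩ c + 1 ∧ latticeGraphIso σ ϖ ((StdForm.antidiagonal 3).over K) γ w = w)} ∧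
        (latticeGraphIso σ ϖ ((StdForm.antidiagonal 3).over K) γ w = w ∧ IsSelfDualLattice σ ϖ ((StdForm.antidiagonal 3).over K) w.1 ∧
          w.1.map ((Matrix.toLin' (((γ : GL (Fin 3) K) : Matrix (Fin 3) (Fin 3) K) - 1)).restrictScalars 𝒪[K]) ≤ scaleLattice (ϖ ^ d₀) w.1)}.ncard = Nat.card 𝓀[K] * b := by
  have h12 := ncard_outward_regDir_add_one_eq_ncard_regDir hσ hvσ hσϖ hϖ hres h2 hnorm hT hγ0 A hA hA' hd hdA s hγA i₀ he hiso hgap hk u hvu hvr hfix hvR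
  rw [hcnt] at h12
  rw [ncard_regionGrandchildren_eq_mul_ncard_regDir hσ hvσ hσϖ hϖ hres h2 hT A hd hdA s hγA i₀ hd2 he hiso hgap hk u hvu hfix hvR, Nat.add_right_cancel h12]

/-! ## §14 The layer sizes of the isoceles region -/

/-- **(V3)(iv) THE LAYER SIZES OF THE ISOCELES REGION FROM THE DIRECTION COUNTS.**  Regular isoceles literal `γ = A·diag(s)·A⁻¹ ∈ K₀` (tame-ramified place, `d₀ ≥ 3`,
`s' ≥ 1`, close-pair gap exactly `|ϖ|^{d₀+2s'}`), `sR` = the root region `{γv = v ∧ SD v ∧ LEV[v](ϖ^{d₀})}`.  HYPOTHESIS `hdir`: every region vertex `v` of distance `< 2s'`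
from the root has a frame `v = u·r₀` in which EXACTLY TWO children `(uκ)·N₁` pass the line test `|⟨(uκ)e₀, A e_{i₀}⟩| < 1 ∧ |⟨(uκ)e₀, ϖ^{s'}·A e_k⟩| < 1` (the set text of
★ `ncard_outward_regDir_add_one_eq_ncard_regDir` ∕ ★ `ncard_adj_regDir_eq_two`).  CONCLUSION: **`sR.card = 1 + 2q·Σ_{i<s'} qⁱ`** and **`#{v ∈ sR | dist(r₀, v) = 2s'} = 2q^{s'}`**
(★ LAYERS with root branching `2q`, interior branching `q` (§13) and `dist ≤ 2s'` on the region (★ DIST)). [cite: Serre1980Trees, I.2.3] [cite: Kottwitz1986, §3]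
[cite: Rogawski1990, §4.9 pp. 54–56] -/
theorem isoceles_regionCard_of_dirCounts [ValuativeRel K] [(Valued.v : Valuation K ℤᵐ⁰).Compatible]
    (hσ : ∀ x, σ (σ x) = x) (hvσ : ∀ a, Valued.v (σ a) = Valued.v a) (hσϖ : σ ϖ = -ϖ)
    (hϖ : Valued.v ϖ = WithZero.exp (-1 : ℤ)) (hres : ∀ x : K, Valued.v x ≤ 1 → Valued.v (σ x - x) < 1) (h2 : Valued.v (2 : K) = 1)
    (hnorm : ∀ u : K, σ u = u → Valued.v (u - 1) < 1 → ∃ z : K, z * σ z = u ∧ Valued.v (z - 1) ≤ Valued.v (u - 1)) [Fintype 𝓀[K]]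
    {γ : unitaryGroupOfForm σ ((StdForm.antidiagonal 3).over K)} (hγ0 : γ ∈ unitaryInt σ ((StdForm.antidiagonal 3).over K))
    (d : Fin 3 → K) (hd : ∀ i, Valued.v (d i) = 1) (hdσ : ∀ i, σ (d i) = d i)
    (A : GL (Fin 3) K) (hA : IsIntMatrix (A : Matrix (Fin 3) (Fin 3) K)) (hA' : IsIntMatrix ((A⁻¹ : GL (Fin 3) K) : Matrix (Fin 3) (Fin 3) K))
    (hdA : Matrix.diagonal d = (-(Matrix.diagonal d).det) • formCongr σ A ((StdForm.antidiagonal 3).over K))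
    (s : Fin 3 → K) (hs1 : s 1 = 1) (hsv : ∀ i, Valued.v (s i) = 1) (hsσ : ∀ i, s i * σ (s i) = 1)
    (hγA : ((γ : GL (Fin 3) K) : Matrix (Fin 3) (Fin 3) K) = (A : Matrix (Fin 3) (Fin 3) K) * Matrix.diagonal s * ((A⁻¹ : GL (Fin 3) K) : Matrix (Fin 3) (Fin 3) K))
    (i₀ : Fin 3) {d₀ : ℕ} (hd3 : 3 ≤ d₀) (he : ∀ i, Valued.v (s i - 1) ≤ Valued.v ϖ ^ d₀)
    (hiso : ∀ j, j ≠ i₀ → Valued.v (s i₀ - s j) = Valued.v ϖ ^ d₀) (hclose : ∀ j k, j ≠ i₀ → k ≠ i₀ → Valued.v (s j - s k) ≤ Valued.v ϖ ^ (d₀ + 2))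
    (hreg : ∀ i j, i ≠ j → s i ≠ s j)
    (q : ℕ) (hq : q = Fintype.card 𝓀[K])
    (sR : Finset {M : Submodule 𝒪[K] (Fin 3 → K) // IsVertex σ ϖ ((StdForm.antidiagonal 3).over K) M}) (hsR : ∀ v, v ∈ sR ↔ v ∈ {v : {M : Submodule 𝒪[K] (Fin 3 → K) // IsVertex σ ϖ ((StdForm.antidiagonal 3).over K) M} | latticeGraphIso σ ϖ ((StdForm.antidiagonal 3).over K) γ v = v ∧ IsSelfDualLattice σ ϖ ((StdForm.antidiagonal 3).over K) v.1 ∧ v.1.map ((Matrix.toLin' (((γ : GL (Fin 3) K) : Matrix (Fin 3) (Fin 3) K) - 1)).restrictScalars 𝒪[K]) ≤ scaleLattice (ϖ ^ d₀) v.1})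
    (s' : ℕ) (hs' : 1 ≤ s') (hgap : ∀ j k, j ≠ i₀ → k ≠ i₀ → j ≠ k → Valued.v (s j - s k) = Valued.v ϖ ^ (d₀ + 2 * s'))
    {k : Fin 3} (hk : k ≠ i₀)
    (hdir : ∀ v ∈ sR, (latticeGraph σ ϖ ((StdForm.antidiagonal 3).over K)).dist ⟨stdLattice K 3, 0, isSelfDualLattice_stdLattice_three_of_v hϖ⟩ v < 2 * s' →
      ∃ u : unitaryGroupOfForm σ ((StdForm.antidiagonal 3).over K), v = latticeGraphIso σ ϖ ((StdForm.antidiagonal 3).over K) u ⟨stdLattice K 3, 0, isSelfDualLattice_stdLattice_three_of_v hϖ⟩ ∧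
        {c : {M : Submodule 𝒪[K] (Fin 3 → K) // IsVertex σ ϖ ((StdForm.antidiagonal 3).over K) M} | (latticeGraph σ ϖ ((StdForm.antidiagonal 3).over K)).Adj v c ∧ ∃ κ : unitaryGroupOfForm σ ((StdForm.antidiagonal 3).over K), κ ∈ unitaryInt σ ((StdForm.antidiagonal 3).over K) ∧
          c = latticeGraphIso σ ϖ ((StdForm.antidiagonal 3).over K) (u * κ) ⟨latt (Matrix.diagonal ![(1 : K), 1, ϖ]), 2, isVertexLattice_two_N₁_of_neg hσϖ hϖ⟩ ∧
          (Valued.v (pairing σ ((StdForm.antidiagonal 3).over K) ((((u * κ : unitaryGroupOfForm σ ((StdForm.antidiagonal 3).over K)) : GL (Fin 3) K) : Matrix (Fin 3) (Fin 3) K) *ᵥ Pi.single 0 1)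
              ((A : Matrix (Fin 3) (Fin 3) K) *ᵥ Pi.single i₀ 1)) < 1 ∧
            Valued.v (pairing σ ((StdForm.antidiagonal 3).over K) ((((u * κ : unitaryGroupOfForm σ ((StdForm.antidiagonal 3).over K)) : GL (Fin 3) K) : Matrix (Fin 3) (Fin 3) K) *ᵥ Pi.single 0 1)
              (ϖ ^ s' • ((A : Matrix (Fin 3) (Fin 3) K) *ᵥ Pi.single k 1))) < 1)}.ncard = 2) :
    sR.card = 1 + 2 * q * ∑ i ∈ Finset.range s', q ^ i ∧
      (sR.filter fun v => (latticeGraph σ ϖ ((StdForm.antidiagonal 3).over K)).dist ⟨stdLattice K 3, 0, isSelfDualLattice_stdLattice_three_of_v hϖ⟩ v = 2 * s').card = 2 * q ^ s' := by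
  classical
  have hϖ0 : ϖ ≠ 0 := fun h0 => by rw [h0, map_zero] at hϖ; exact WithZero.coe_ne_zero hϖ.symm
  have hd2 : 2 ≤ d₀ := by omega
  have hqk : Nat.card 𝓀[K] = q := by rw [hq, Nat.card_eq_fintype_card]
  have hTree := isTree_latticeGraph_three_of_neg hσ hvσ hϖ hσϖ hres h2 hnorm
  set G := latticeGraph σ ϖ ((StdForm.antidiagonal 3).over K) with hG
  set r : {M : Submodule 𝒪[K] (Fin 3 → K) // IsVertex σ ϖ ((StdForm.antidiagonal 3).over K) M} :=
    ⟨stdLattice K 3, 0, isSelfDualLattice_stdLattice_three_of_v hϖ⟩ with hr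
  set F : Set {M : Submodule 𝒪[K] (Fin 3 → K) // IsVertex σ ϖ ((StdForm.antidiagonal 3).over K) M} :=
    {v | latticeGraphIso σ ϖ ((StdForm.antidiagonal 3).over K) γ v = v} with hFdef
  set R : Set {M : Submodule 𝒪[K] (Fin 3 → K) // IsVertex σ ϖ ((StdForm.antidiagonal 3).over K) M} :=
    {v | latticeGraphIso σ ϖ ((StdForm.antidiagonal 3).over K) γ v = v ∧ IsSelfDualLattice σ ϖ ((StdForm.antidiagonal 3).over K) v.1 ∧
      v.1.map ((Matrix.toLin' (((γ : GL (Fin 3) K) : Matrix (Fin 3) (Fin 3) K) - 1)).restrictScalars 𝒪[K]) ≤ scaleLattice (ϖ ^ d₀) v.1} with hRdef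
  set GC : {M : Submodule 𝒪[K] (Fin 3 → K) // IsVertex σ ϖ ((StdForm.antidiagonal 3).over K) M} → Set {M : Submodule 𝒪[K] (Fin 3 → K) // IsVertex σ ϖ ((StdForm.antidiagonal 3).over K) M} :=
    fun v => {w | ∃ c, (G.Adj v c ∧ G.dist r c = G.dist r v + 1 ∧ latticeGraphIso σ ϖ ((StdForm.antidiagonal 3).over K) γ c = c) ∧
      (G.Adj c w ∧ G.dist r w = G.dist r c + 1 ∧ latticeGraphIso σ ϖ ((StdForm.antidiagonal 3).over K) γ w = w)} with hGCdef
  -- the rooted tree of fixed vertices (★ ENGINE ED. 3 bookkeeping, as in ★ JUNCTION IV)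
  have hFfin : F.Finite := finite_setOf_latticeGraphIso_eq_of_eigenframe hvσ hϖ d hd hdσ A hdA s hsv hsσ hγA hreg
  have hrF : r ∈ F := latticeGraphIso_root_eq_of_mem_unitaryInt hϖ hγ0
  have hF : ∀ w ∈ F, w ≠ r → ∀ u, G.Adj w u → G.dist r u + 1 = G.dist r w → u ∈ F :=
    parentClosed_fixedPoints hTree r (latticeGraphIso σ ϖ ((StdForm.antidiagonal 3).over K) γ) hrF
  have hSD₁ : ∀ v c : {M : Submodule 𝒪[K] (Fin 3 → K) // IsVertex σ ϖ ((StdForm.antidiagonal 3).over K) M}, G.Adj v c →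
      IsSelfDualLattice σ ϖ ((StdForm.antidiagonal 3).over K) v.1 → ¬ IsSelfDualLattice σ ϖ ((StdForm.antidiagonal 3).over K) c.1 :=
    fun v c hvc hv => (isSelfDualLattice_iff_not_isSelfDualLattice_of_adj_of_v hvσ hϖ hvc).1 hv
  have hSD₂ : ∀ c w : {M : Submodule 𝒪[K] (Fin 3 → K) // IsVertex σ ϖ ((StdForm.antidiagonal 3).over K) M}, G.Adj c w →
      ¬ IsSelfDualLattice σ ϖ ((StdForm.antidiagonal 3).over K) c.1 → IsSelfDualLattice σ ϖ ((StdForm.antidiagonal 3).over K) w.1 := by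
    intro c w hcw hc
    by_contra hw
    exact hc ((isSelfDualLattice_iff_not_isSelfDualLattice_of_adj_of_v hvσ hϖ hcw).2 hw)
  have hGC : ∀ v w, w ∈ GC v ↔ ∃ c, (G.Adj v c ∧ G.dist r c = G.dist r v + 1 ∧ c ∈ F) ∧ (G.Adj c w ∧ G.dist r w = G.dist r c + 1 ∧ w ∈ F) :=
    fun v w => Iff.rfl
  have hrootLev : r.1.map ((Matrix.toLin' (((γ : GL (Fin 3) K) : Matrix (Fin 3) (Fin 3) K) - 1)).restrictScalars 𝒪[K]) ≤ scaleLattice (ϖ ^ d₀) r.1 :=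
    map_sub_one_stdLattice_le_scaleLattice_of_eigenframe A hA hA' s hγA (pow_ne_zero d₀ hϖ0) (fun i => by rw [map_pow]; exact he i)
  have hrfix : latticeGraphIso σ ϖ ((StdForm.antidiagonal 3).over K) γ r = r := hrF
  have hrR : r ∈ R := ⟨hrfix, isSelfDualLattice_stdLattice_three_of_v hϖ, hrootLev⟩
  have hRF : R ⊆ F := fun v hv => hv.1
  have hRS : ∀ v ∈ R, IsSelfDualLattice σ ϖ ((StdForm.antidiagonal 3).over K) v.1 := fun v hv => hv.2.1
  have hRup : ∀ v ∈ F, IsSelfDualLattice σ ϖ ((StdForm.antidiagonal 3).over K) v.1 → ∀ w ∈ GC v, w ∈ R → v ∈ R :=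
    fun v hvF hvS w hw hwR => ⟨hvF, hvS, row_regionUpClosed_of_neg hσ hvσ hσϖ hϖ hres h2 hnorm hTree hγ0 d hd hdσ A hA hA' hdA s hs1 hsv hsσ hγA i₀ hd3 he hiso hclose
      hvS hvF hw hwR.2.2⟩
  have hsRR : ∀ v, v ∈ sR ↔ v ∈ R := hsR
  -- the branching numbers: `2q` at the root, `q` inside, and `dist ≤ 2s'` on the region
  have hroot : {w | w ∈ GC r ∧ w ∈ R}.ncard = 2 * q := by
    obtain ⟨u₀, hru, hcnt⟩ := hdir r ((hsRR r).2 hrR) (by rw [SimpleGraph.dist_self]; omega)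
    have h := ncard_regionGrandchildren_root_eq_of_dirCount hσ hvσ hσϖ hϖ hres h2 hTree hγ0 A hA hA' hd hdA s hγA i₀ hd2 he hiso hgap hk u₀ hru hcnt
    rw [hqk, mul_comm] at h
    exact h
  have hint : ∀ v ∈ R, v ≠ r → G.dist r v < 2 * s' → {w | w ∈ GC v ∧ w ∈ R}.ncard = q := by
    intro v hvR hvr hdist
    obtain ⟨u, hvu, hcnt⟩ := hdir v ((hsRR v).2 hvR) hdist
    have h := ncard_regionGrandchildren_eq_of_dirCount hσ hvσ hσϖ hϖ hres h2 hnorm hTree hγ0 A hA hA' hd hdA s hγA i₀ hd2 he hiso hgap hk u hvu hvr hvR.1 hvR.2.2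
      (b := 1) hcnt
    rw [hqk, mul_one] at h
    exact h
  have hmax : ∀ v ∈ R, G.dist r v ≤ 2 * s' := fun v hv =>
    dist_root_le_of_lev_of_neg hσ hvσ hσϖ hϖ hres h2 hnorm A hA hA' hd hdA s hγA i₀ he hiso hgap hv.2.1 hv.2.2
  have hRset : R = ↑sR := by ext v; rw [Finset.mem_coe, hsRR]
  refine ⟨?_, ?_⟩
  · have h := ncard_region_eq_of_branching hTree r F hFfin hF _ hSD₁ hSD₂ GC hGC R hrR hRF hRS hRup s' (2 * q) q hroot hint hmax
    rw [hRset, Set.ncard_coe_finset] at h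
    rw [h, mul_assoc]
  · have h := ncard_regionLayer_eq_of_branching hTree r F hFfin hF _ hSD₁ hSD₂ GC hGC R hrR hRF hRS hRup s' (2 * q) q hroot hint hs' le_rfl
    have hset : {v | v ∈ R ∧ G.dist r v = 2 * s'} = ↑(sR.filter fun v => G.dist r v = 2 * s') := by
      ext v; rw [Set.mem_setOf_eq, Finset.mem_coe, Finset.mem_filter, hsRR]
    rw [hset, Set.ncard_coe_finset] at h
    rw [h, mul_assoc, ← pow_succ', Nat.sub_add_cancel hs']

/-! ## §15 (ED. 2) The layer sizes from the hyperbolicity token alone -/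

/-- **(V3)(iv)′ THE LAYER SIZES OF THE ISOCELES REGION OF A HYPERBOLIC LITERAL** — §14 with the direction counts DISCHARGED: binders = `row_S45_hyperbolic` (S45 v4 :46) ordered
subset + the close pair `{j, k}` and the hyperbolicity token `hhyp : ∃ t, |t| = 1 ∧ |d_j + tσ(t)d_k| < 1`.  Per region vertex `v` of distance `< 2s'`: off the root, ★ J-END gives
`ϖ^{s'−1}·A e_k ∈ v`, ★ V0 an adapted frame `v = u·r₀` with `|⟨A e_{i₀}, u e₀⟩| < 1`, and ★ (V3′) `ncard_regDir_eq_two_of_adapted` the two region directions; at the root ★ (V3′) ED. 2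
`exists_regDir_root_child_of_hyperbolic` (the witness `A(e_j + t e_k)`) ∘ ★ `exists_adaptedFrame_root_of_regDir` give the adapted frame.  CONCLUSION: the `hcard` ∕ `hend` texts of
★ `sum_regionTokens_hyperbolic_pool`: **`sR.card = 1 + 2q·Σ_{i<s'} qⁱ`**, **`#{v ∈ sR | dist(r₀, v) = 2s'} = 2q^{s'}`**. [cite: Serre1980Trees, I.2.3] [cite: Kottwitz1986, §3]
[cite: Rogawski1990, §4.9 pp. 54–56] -/
theorem isoceles_regionCard_of_hyperbolic [ValuativeRel K] [(Valued.v : Valuation K ℤᵐ⁰).Compatible]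
    (hσ : ∀ x, σ (σ x) = x) (hvσ : ∀ a, Valued.v (σ a) = Valued.v a) (hσϖ : σ ϖ = -ϖ)
    (hϖ : Valued.v ϖ = WithZero.exp (-1 : ℤ)) (hres : ∀ x : K, Valued.v x ≤ 1 → Valued.v (σ x - x) < 1) (h2 : Valued.v (2 : K) = 1)
    (hnorm : ∀ u : K, σ u = u → Valued.v (u - 1) < 1 → ∃ z : K, z * σ z = u ∧ Valued.v (z - 1) ≤ Valued.v (u - 1)) [Fintype 𝓀[K]]
    {γ : unitaryGroupOfForm σ ((StdForm.antidiagonal 3).over K)} (hγ0 : γ ∈ unitaryInt σ ((StdForm.antidiagonal 3).over K))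
    (d : Fin 3 → K) (hd : ∀ i, Valued.v (d i) = 1) (hdσ : ∀ i, σ (d i) = d i)
    (A : GL (Fin 3) K) (hA : IsIntMatrix (A : Matrix (Fin 3) (Fin 3) K)) (hA' : IsIntMatrix ((A⁻¹ : GL (Fin 3) K) : Matrix (Fin 3) (Fin 3) K))
    (hdA : Matrix.diagonal d = (-(Matrix.diagonal d).det) • formCongr σ A ((StdForm.antidiagonal 3).over K))
    (s : Fin 3 → K) (hs1 : s 1 = 1) (hsv : ∀ i, Valued.v (s i) = 1) (hsσ : ∀ i, s i * σ (s i) = 1)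
    (hγA : ((γ : GL (Fin 3) K) : Matrix (Fin 3) (Fin 3) K) = (A : Matrix (Fin 3) (Fin 3) K) * Matrix.diagonal s * ((A⁻¹ : GL (Fin 3) K) : Matrix (Fin 3) (Fin 3) K))
    (i₀ : Fin 3) {d₀ : ℕ} (hd3 : 3 ≤ d₀) (he : ∀ i, Valued.v (s i - 1) ≤ Valued.v ϖ ^ d₀)
    (hiso : ∀ j, j ≠ i₀ → Valued.v (s i₀ - s j) = Valued.v ϖ ^ d₀) (hclose : ∀ j k, j ≠ i₀ → k ≠ i₀ → Valued.v (s j - s k) ≤ Valued.v ϖ ^ (d₀ + 2))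
    (hreg : ∀ i j, i ≠ j → s i ≠ s j)
    (q : ℕ) (hq : q = Fintype.card 𝓀[K])
    (sR : Finset {M : Submodule 𝒪[K] (Fin 3 → K) // IsVertex σ ϖ ((StdForm.antidiagonal 3).over K) M}) (hsR : ∀ v, v ∈ sR ↔ v ∈ {v : {M : Submodule 𝒪[K] (Fin 3 → K) // IsVertex σ ϖ ((StdForm.antidiagonal 3).over K) M} | latticeGraphIso σ ϖ ((StdForm.antidiagonal 3).over K) γ v = v ∧ IsSelfDualLattice σ ϖ ((StdForm.antidiagonal 3).over K) v.1 ∧ v.1.map ((Matrix.toLin' (((γ : GL (Fin 3) K) : Matrix (Fin 3) (Fin 3) K) - 1)).restrictScalars 𝒪[K]) ≤ scaleLattice (ϖ ^ d₀) v.1})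
    (s' : ℕ) (hs' : 1 ≤ s') (hgap : ∀ j k, j ≠ i₀ → k ≠ i₀ → j ≠ k → Valued.v (s j - s k) = Valued.v ϖ ^ (d₀ + 2 * s'))
    {j k : Fin 3} (hj : j ≠ i₀) (hk : k ≠ i₀) (hjk : j ≠ k)
    (hhyp : ∃ t : K, Valued.v t = 1 ∧ Valued.v (d j + t * σ t * d k) < 1) :
    sR.card = 1 + 2 * q * ∑ i ∈ Finset.range s', q ^ i ∧
      (sR.filter fun v => (latticeGraph σ ϖ ((StdForm.antidiagonal 3).over K)).dist ⟨stdLattice K 3, 0, isSelfDualLattice_stdLattice_three_of_v hϖ⟩ v = 2 * s').card = 2 * q ^ s' := by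
  have hϖ1 : Valued.v ϖ ≤ 1 := by rw [hϖ, ← WithZero.exp_zero]; exact WithZero.exp_le_exp.2 (by norm_num)
  have hTree := isTree_latticeGraph_three_of_neg hσ hvσ hϖ hσϖ hres h2 hnorm
  refine isoceles_regionCard_of_dirCounts hσ hvσ hσϖ hϖ hres h2 hnorm hγ0 d hd hdσ A hA hA' hdA s hs1 hsv hsσ hγA i₀ hd3 he hiso hclose hreg q hq sR hsR
    s' hs' hgap hk fun v hv hdist => ?_
  obtain ⟨hfix, hvS, hvR⟩ := (hsR v).1 hv
  by_cases hvr : v = ⟨stdLattice K 3, 0, isSelfDualLattice_stdLattice_three_of_v hϖ⟩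
  · -- the root: a region-direction child from `hhyp`, then the adapted root frame
    subst hvr
    obtain ⟨κ₁, hκ₁, hreg₁⟩ := exists_regDir_root_child_of_hyperbolic hσ hvσ hσϖ hϖ hres h2 hd A hA hA' hdA i₀ hs' hj hk hjk hhyp
    obtain ⟨u₀, hru, hlam₀, -⟩ := exists_adaptedFrame_root_of_regDir hσ hvσ hϖ A i₀ s' k hκ₁ hreg₁
    have hne₀ : ϖ ^ (s' - 1) • ((A : Matrix (Fin 3) (Fin 3) K) *ᵥ Pi.single k 1) ∈
        (⟨stdLattice K 3, 0, isSelfDualLattice_stdLattice_three_of_v hϖ⟩ : {M : Submodule 𝒪[K] (Fin 3 → K) // IsVertex σ ϖ ((StdForm.antidiagonal 3).over K) M}).1 :=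
      scaleLattice_le_self_of_v_le_one (by rw [map_pow]; exact pow_le_one' hϖ1 _) _
        (pow_smul_coe_mulVec_single_mem_scaleLattice_stdLattice hϖ A hA k (s' - 1))
    exact ⟨u₀, hru, ncard_regDir_eq_two_of_adapted hσ hvσ hσϖ hϖ hres h2 hd A hdA s hγA i₀ he hiso hs' hgap hk u₀ hru hvS hvR hlam₀ hne₀⟩
  · -- an interior vertex: `ϖ^{s'-1}·A e_k ∈ v` by J-END, then the adapted frame of V0
    obtain ⟨u, hvu, -, -, hlam, -⟩ :=
      exists_adaptedFrame_of_mem_region hσ hvσ hσϖ hϖ hres h2 hnorm hTree hγ0 d hd A hA hA' hdA s hγA i₀ he hiso hgap hk hvS hvr hfix hvR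
    have hne : ϖ ^ (s' - 1) • ((A : Matrix (Fin 3) (Fin 3) K) *ᵥ Pi.single k 1) ∈ v.1 := by
      by_contra hmem
      have h2s := (dist_root_eq_two_mul_iff_not_pow_smul_mem_of_neg hσ hvσ hσϖ hϖ hres h2 hnorm A hA hA' hd hdA s hγA i₀ he hiso hgap hs' hvS hvR hk).2 hmem
      omega
    exact ⟨u, hvu, ncard_regDir_eq_two_of_adapted hσ hvσ hσϖ hϖ hres h2 hd A hdA s hγA i₀ he hiso hs' hgap hk u hvu hvS hvR hlam hne⟩

end Literature.NumberTheory.Automorphic.UnitaryLatticeTree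

end
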